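/- Copyright: ym3-torus cell, WIDTH-5 ATTACH seat `ym-ust-19936-w4` (prover, g10), for crux `HistoryTailL` (stmt-QuantumFields-19936),
level-0 prefactor-free infrastructure (T2b∕c) of LINE `local_insertion` (#13) ∕ K1.  Released under the licence of the surrounding project. -/
import Summits.QuantumFields.YangMills.Theorems.LocalInsertionTriangularHaarIntegration
import Literature.MathematicalPhysics.QuantumFieldTheory.WilsonPlaquetteExpMomentSandwich
import Literature.MathematicalPhysics.QuantumFieldTheory.StrongCouplingActivities
import HarnessLib

/-!
# The triangular upper bound on the three-torus: `∫ ∏_p w_p(U_p) dHaar ≤ z^{2n³ − n² − n}`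

Support file (`--supports stmt-QuantumFields-19936 --as helper`), steps (T2b)+(T2c) of the cell's level-0 PREFACTOR-FREE plan (memo
`PREFACTOR-FREE-LEVEL0-w7g9.md` §1 (c); LEAD ★w1-19936 g7 00:09:18Z «w4 = (T2) torus-direct»): the UPPER half of the free-energy
sandwich that the door ✓`WilsonPlaquetteExpMomentSandwich.integral_exp_mul_plaquette_le_of_sandwich` consumes as `hZup`.

(T2b) THE ELIMINATION ORDER ON `(ℤ∕nℤ)³` (inside the proof of §2's theorem; no definition): the ASSIGNED links are the direction-1
links `(x,1)` with `x₀ ≠ 0` and the direction-2 links `(x,2)` with `(x₀,x₁) ≠ (0,0)`; the PRIVATE PLAQUETTE of an assigned link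
`(x,i)` is `(x − e_k; k, i)` with `k = 0` if `x₀ ≠ 0`, else `k = 1` — its holonomy `U(x−e_k,k)·U(x,i)·U(x−e_k+e_i,k)⁻¹·U(x−e_k,i)⁻¹`
has the assigned link as its SECOND letter and the other three letters on links that are unassigned or of HIGHER rank for
`r(x,1) = 3n − x₀`, `r(x,2) = n − x₀` (`x₀ ≠ 0`), `r(x,2) = 2n − x₁` (`x₀ = 0`); distinct assigned links have distinct private
plaquettes; `#assigned = (n³ − n²) + (n³ − n) = 2n³ − n² − n` (the wrap layers `x₀ = 0` resp. `x₀ = x₁ = 0` and all direction-0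
links stay unassigned: no gauge fixing, no box comparison).

(T2c) **`integral_prod_plaquetteWeight_le_pow`** — for ANY bi-invariant probability measure `μ₀` on a measurable group `G` and ANY
measurable plaquette weights `0 ≤ w_p ≤ 1` with `∫ w_p dμ₀ ≤ z`: `∫ ∏_{p} w_p(U_p) dμ₀^{E} ≤ z^{2n³ − n² − n}` (drop the unassigned
plaquettes, `w ≤ 1`; the assigned ones are independent Haar words by ✓`TriangularHaar.integral_prod_words_mul_le_pow`).  §3
**`lintegral_exp_neg_mul_wilsonAction_le`** — the door's `hZup` letter: for a compact group `G`, a continuous unitary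
`ρ : G →* M_N(ℂ)` and `β′ ≥ 0`,
`∫⁻ exp(−β′·S_W(U)) dπ ≤ ofReal ((∫ exp(−β′(N − Re tr ρ g)) dHaar)^{2n³ − n² − n})` on `GaugeConfig 3 n G`.

HONEST SCOPE.  Folklore (Haar invariance + a linear extension of the lattice's partial order; M. Creutz, *Quarks, gluons and
lattices* Ch. 9; S. Chatterjee, arXiv:1602.01222 §3); the matching LOWER bound (T1′, ★w7-19936 g9) and the one-link Gaussian
integral `z_{SU(2)}(β′) ≤ C β′^{−3∕2}` (T2d) are NOT here; nothing of the exponential moment (EM), of LINE #13's stubs, of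
`HistoryTailL` or of any crux is proved; the eventual (EM) carries the residual `β^{c∕n}` which is NOT γ-uniform at fixed small
`K` (LEAD g7 caveat) and is never to be worded as `stub_insertionHeightOne`.  YM₃ on T³ is rung R3 — not d = 4, not infinite volume,
not a mass gap, not Clay.
-/

namespace Summit.QuantumFields.YangMills.Theorems.LocalInsertion.TriangularPlaquette

open MeasureTheory Finset
open Literature.MathematicalPhysics.QuantumFieldTheory
open Literature.MathematicalPhysics.QuantumFieldTheory.LatticeRP (piMeasure)
open Summit.QuantumFields.YangMills.Theorems.LocalInsertion.TriangularHaar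

noncomputable section

/-! ## §1 Counting on the three-torus -/

/-- `#{x ∈ (ℤ∕n)³ | x₀ = 0} = n²`. [folklore] -/
theorem card_filter_apply_zero (n : ℕ) [NeZero n] :
    (univ.filter fun x : Site 3 n => x 0 = 0).card = n ^ 2 := by
  have e : {x : Site 3 n // x 0 = 0} ≃ (Fin 2 → ZMod n) :=
    { toFun := fun x i => x.1 i.succ
      invFun := fun y => ⟨Fin.cons 0 y, by simp⟩
      left_inv := fun x => by
        refine Subtype.ext (funext fun i => ?_)
        refine Fin.cases ?_ (fun j => ?_) i
        · simpa using x.2.symm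
        · simp
      right_inv := fun y => funext fun i => by simp }
  rw [← Fintype.card_subtype, Fintype.card_congr e, Fintype.card_fun, ZMod.card, Fintype.card_fin]

/-- `#{x ∈ (ℤ∕n)³ | x₀ = 0 ∧ x₁ = 0} = n`. [folklore] -/
theorem card_filter_apply_zero_one (n : ℕ) [NeZero n] :
    (univ.filter fun x : Site 3 n => x 0 = 0 ∧ x 1 = 0).card = n := by
  have h02 : (0 : Fin 3) ≠ 2 := by decide
  have h12 : (1 : Fin 3) ≠ 2 := by decide
  have e : {x : Site 3 n // x 0 = 0 ∧ x 1 = 0} ≃ ZMod n :=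
    { toFun := fun x => x.1 2
      invFun := fun c => ⟨fun i => if i = 2 then c else 0, by simp [h02, h12]⟩
      left_inv := fun x => by
        refine Subtype.ext (funext fun i => ?_)
        fin_cases i
        · simpa [h02] using x.2.1.symm
        · simpa [h12] using x.2.2.symm
        · simp
      right_inv := fun c => by simp }
  rw [← Fintype.card_subtype, Fintype.card_congr e, ZMod.card]

/-- `#(ℤ∕n)³ = n³`. [folklore] -/
theorem card_site_three (n : ℕ) [NeZero n] : (univ : Finset (Site 3 n)).card = n ^ 3 := by
  rw [card_univ, Fintype.card_fun, ZMod.card, Fintype.card_fin]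

/-- **THE NUMBER OF ASSIGNED LINKS IS `2n³ − n² − n`.** [folklore] -/
theorem card_assigned (n : ℕ) [NeZero n] :
    (univ.filter fun e : Edge 3 n =>
        (e.2 = 1 ∧ e.1 0 ≠ 0) ∨ (e.2 = 2 ∧ ¬(e.1 0 = 0 ∧ e.1 1 = 0))).card = 2 * n ^ 3 - n ^ 2 - n := by
  rw [filter_or, card_union_of_disjoint]
  swap
  · rw [disjoint_filter]
    rintro e - ⟨h1, -⟩ ⟨h2, -⟩
    rw [h1] at h2
    exact absurd h2 (by decide)
  have hA₁ : (univ.filter fun e : Edge 3 n => e.2 = 1 ∧ e.1 0 ≠ 0) =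
      (univ.filter fun x : Site 3 n => x 0 ≠ 0) ×ˢ (univ.filter fun i : Fin 3 => i = 1) := by
    ext e
    simp only [mem_filter, mem_univ, true_and, mem_product]
    tauto
  have hA₂ : (univ.filter fun e : Edge 3 n => e.2 = 2 ∧ ¬(e.1 0 = 0 ∧ e.1 1 = 0)) =
      (univ.filter fun x : Site 3 n => ¬(x 0 = 0 ∧ x 1 = 0)) ×ˢ (univ.filter fun i : Fin 3 => i = 2) := by
    ext e
    simp only [mem_filter, mem_univ, true_and, mem_product]
    tauto
  have hi1 : (univ.filter fun i : Fin 3 => i = 1).card = 1 := by decide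
  have hi2 : (univ.filter fun i : Fin 3 => i = 2).card = 1 := by decide
  have h0 : (univ.filter fun x : Site 3 n => x 0 ≠ 0).card = n ^ 3 - n ^ 2 := by
    have h := card_filter_add_card_filter_not (s := (univ : Finset (Site 3 n))) (fun x : Site 3 n => x 0 = 0)
    rw [card_filter_apply_zero, card_site_three] at h
    have h' : (univ.filter fun x : Site 3 n => x 0 ≠ 0) = (univ.filter fun x : Site 3 n => ¬ x 0 = 0) := rfl
    rw [h']
    omega
  have h01 : (univ.filter fun x : Site 3 n => ¬(x 0 = 0 ∧ x 1 = 0)).card = n ^ 3 - n := by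
    have h := card_filter_add_card_filter_not (s := (univ : Finset (Site 3 n)))
      (fun x : Site 3 n => x 0 = 0 ∧ x 1 = 0)
    rw [card_filter_apply_zero_one, card_site_three] at h
    omega
  rw [hA₁, hA₂, card_product, card_product, hi1, hi2, h0, h01]
  have h1 : n ≤ n ^ 2 := by nlinarith
  have h2 : n ^ 2 ≤ n ^ 3 := by nlinarith
  omega

/-! ## §2 The triangular bound for plaquette weights on the three-torus -/

/-- `1 ≤ x₀.val` and `(x₀ − 1).val = x₀.val − 1` for `x₀ ≠ 0` in `ℤ∕n`, `1 < n`. [folklore] -/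
theorem val_sub_one_of_ne_zero {n : ℕ} [NeZero n] (hn : 1 < n) {a : ZMod n} (ha : a ≠ 0) :
    1 ≤ a.val ∧ (a - 1).val = a.val - 1 := by
  haveI : Fact (1 < n) := ⟨hn⟩
  have h1 : 1 ≤ a.val := by
    rw [Nat.one_le_iff_ne_zero]
    exact fun h => ha ((ZMod.val_eq_zero a).1 h)
  refine ⟨h1, ?_⟩
  rw [ZMod.val_sub (by rw [ZMod.val_one]; exact h1), ZMod.val_one]

/-- `x − e_k ≠ x` on `(ℤ∕n)³`, `1 < n`. [folklore] -/
theorem sub_single_ne {n : ℕ} [NeZero n] (hn : 1 < n) (x : Site 3 n) (k : Fin 3) : x - Pi.single k 1 ≠ x := by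
  haveI : Fact (1 < n) := ⟨hn⟩
  intro h
  have h1 := congrFun h k
  simp only [Pi.sub_apply, Pi.single_eq_same, sub_eq_self] at h1
  exact one_ne_zero h1

/-- **THE TRIANGULAR BOUND ON THE THREE-TORUS.**  For a measurable group `G` with a bi-invariant probability measure `μ₀`,
`1 < n`, and measurable plaquette weights `0 ≤ w_p ≤ 1` on the `3n³` plaquettes of `(ℤ∕nℤ)³` with one-link Haar integrals
`∫ w_p dμ₀ ≤ z`:  `∫ ∏_p w_p(U_p) dμ₀^{E} ≤ z^{2n³ − n² − n}` (`U_p` = the tree's `plaquetteHolonomy`).  Proof: the elimination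
order (T2b) of the header feeds ✓`TriangularHaar.integral_prod_words_mul_le_pow` with the `2n³ − n² − n` private plaquettes as words
and the remaining plaquettes as the dropped factor `R ≤ 1`. [folklore] -/
theorem integral_prod_plaquetteWeight_le_pow {n : ℕ} [NeZero n] (hn : 1 < n)
    {G : Type*} [Group G] [MeasurableSpace G] [MeasurableMul₂ G] [MeasurableInv G]
    (μ₀ : Measure G) [IsProbabilityMeasure μ₀] [μ₀.IsMulLeftInvariant] [μ₀.IsMulRightInvariant]
    (w : Plaquette 3 n → G → ℝ) (hwm : ∀ p, Measurable (w p)) (hw0 : ∀ p g, 0 ≤ w p g) (hw1 : ∀ p g, w p g ≤ 1)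
    {z : ℝ} (hz : ∀ p, ∫ g, w p g ∂μ₀ ≤ z) :
    ∫ U, ∏ p : Plaquette 3 n, w p (plaquetteHolonomy U p.1 p.2.1.1 p.2.1.2) ∂piMeasure μ₀ ≤
      z ^ (2 * n ^ 3 - n ^ 2 - n) := by
  haveI : Fact (1 < n) := ⟨hn⟩
  -- (T2b) the data: assigned links, ranks, the eliminated direction `k`, the base point `y = x − e_k`, letters, plaquette
  set A : Finset (Edge 3 n) := univ.filter fun e : Edge 3 n =>
    (e.2 = 1 ∧ e.1 0 ≠ 0) ∨ (e.2 = 2 ∧ ¬(e.1 0 = 0 ∧ e.1 1 = 0)) with hA_def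
  set r : Edge 3 n → ℕ := fun e =>
    if e.2 = 1 then 3 * n - (e.1 0).val else if e.1 0 ≠ 0 then n - (e.1 0).val else 2 * n - (e.1 1).val with hr_def
  set kOf : Site 3 n → Fin 3 := fun x => if x 0 ≠ 0 then 0 else 1 with hk_def
  set yOf : Edge 3 n → Site 3 n := fun e => e.1 - Pi.single (kOf e.1) 1 with hy_def
  set a : Edge 3 n → (Edge 3 n → G) → G := fun e U => U (yOf e, kOf e.1) with ha_def
  set b : Edge 3 n → (Edge 3 n → G) → G := fun e U =>
    (U (yOf e + Pi.single e.2 1, kOf e.1))⁻¹ * (U (yOf e, e.2))⁻¹ with hb_def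
  set P : Edge 3 n → Plaquette 3 n := fun e =>
    if h : kOf e.1 < e.2 then (yOf e, ⟨(kOf e.1, e.2), h⟩) else (0, ⟨((0 : Fin 3), (1 : Fin 3)), by decide⟩)
    with hP_def
  -- membership in `A` and the values of `r`, unfolded
  have hmemA : ∀ e : Edge 3 n, e ∈ A ↔ (e.2 = 1 ∧ e.1 0 ≠ 0) ∨ (e.2 = 2 ∧ ¬(e.1 0 = 0 ∧ e.1 1 = 0)) := fun e => by
    rw [hA_def, mem_filter]; simp
  have h12 : (1 : Fin 3) ≠ 2 := by decide
  have h21 : (2 : Fin 3) ≠ 1 := by decide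
  have h01 : (0 : Fin 3) ≠ 1 := by decide
  have h02 : (0 : Fin 3) ≠ 2 := by decide
  have h10 : (1 : Fin 3) ≠ 0 := by decide
  have hmemA0 : ∀ y : Site 3 n, (y, (0 : Fin 3)) ∉ A := fun y h => by
    rcases (hmemA _).1 h with ⟨h1, -⟩ | ⟨h2, -⟩
    · exact h01 h1
    · exact h02 h2
  have hmemA1 : ∀ y : Site 3 n, (y, (1 : Fin 3)) ∈ A ↔ y 0 ≠ 0 := fun y => by
    rw [hmemA]
    constructor
    · rintro (⟨-, h⟩ | ⟨h, -⟩)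
      · exact h
      · exact absurd h h12
    · exact fun h => Or.inl ⟨rfl, h⟩
  have hmemA2 : ∀ y : Site 3 n, (y, (2 : Fin 3)) ∈ A ↔ ¬(y 0 = 0 ∧ y 1 = 0) := fun y => by
    rw [hmemA]
    constructor
    · rintro (⟨h, -⟩ | ⟨-, h⟩)
      · exact absurd h h21
      · exact h
    · exact fun h => Or.inr ⟨rfl, h⟩
  have hr1 : ∀ y : Site 3 n, r (y, 1) = 3 * n - (y 0).val := fun y => by
    rw [hr_def]; dsimp only; rw [if_pos rfl]
  have hr2 : ∀ y : Site 3 n, r (y, 2) = if y 0 ≠ 0 then n - (y 0).val else 2 * n - (y 1).val := fun y => by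
    rw [hr_def]; dsimp only; rw [if_neg h21]
  have hval : ∀ x : Site 3 n, (x 0).val < n ∧ (x 1).val < n := fun x => ⟨ZMod.val_lt _, ZMod.val_lt _⟩
  -- the eliminated direction lies below the link's direction on `A`
  have hklt : ∀ e ∈ A, kOf e.1 < e.2 := by
    intro e he
    rcases (hmemA e).1 he with ⟨h1, h0⟩ | ⟨h2, -⟩
    · have : kOf e.1 = 0 := by rw [hk_def]; dsimp only; rw [if_pos h0]
      rw [this, h1]; decide
    · rw [h2]
      by_cases h0 : e.1 0 ≠ 0
      · have : kOf e.1 = 0 := by rw [hk_def]; dsimp only; rw [if_pos h0]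
        rw [this]; decide
      · have : kOf e.1 = 1 := by rw [hk_def]; dsimp only; rw [if_neg h0]
        rw [this]; decide
  have hP : ∀ (e : Edge 3 n) (he : e ∈ A), P e = (yOf e, ⟨(kOf e.1, e.2), hklt e he⟩) := fun e he => by
    rw [hP_def]; dsimp only; rw [dif_pos (hklt e he)]
  -- (i) the private plaquette's holonomy is the word `a·U(e)·b`
  have hshift : ∀ e : Edge 3 n, Site.shift (yOf e) (kOf e.1) = e.1 := fun e => by
    show e.1 - Pi.single (kOf e.1) 1 + Pi.single (kOf e.1) 1 = e.1
    exact sub_add_cancel _ _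
  have hword : ∀ e ∈ A, ∀ U : Edge 3 n → G,
      w (P e) (plaquetteHolonomy U (P e).1 (P e).2.1.1 (P e).2.1.2) = w (P e) (a e U * U e * b e U) := by
    intro e he U
    congr 1
    rw [hP e he]
    show plaquetteHolonomy U (yOf e) (kOf e.1) e.2 = _
    rw [plaquetteHolonomy, hshift e, ha_def, hb_def]
    dsimp only
    rw [show Site.shift (yOf e) e.2 = yOf e + Pi.single e.2 1 from rfl, ← mul_assoc]
  -- (ii) injectivity of the private plaquette on `A`
  have hinj : ∀ e ∈ A, ∀ e' ∈ A, P e = P e' → e = e' := by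
    intro e he e' he' hPe
    rw [hP e he, hP e' he'] at hPe
    have hy : yOf e = yOf e' := congrArg Prod.fst hPe
    have hki : (kOf e.1, e.2) = (kOf e'.1, e'.2) := congrArg (fun q : Plaquette 3 n => q.2.1) hPe
    obtain ⟨hk, hi⟩ := Prod.mk.inj hki
    have hx : e.1 = e'.1 := by rw [← hshift e, ← hshift e', hy, hk]
    exact Prod.ext hx hi
  -- (iii) the rank separates each private plaquette's other letters
  have hdep : ∀ e ∈ A, DependsOn (a e) {j : Edge 3 n | j ≠ e ∧ (j ∈ A → r e < r j)} ∧
      DependsOn (b e) {j : Edge 3 n | j ≠ e ∧ (j ∈ A → r e < r j)} := by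
    intro e he
    obtain ⟨x, i⟩ := e
    -- the two cases for the eliminated direction
    have hk_cases : (x 0 ≠ 0 ∧ kOf x = 0) ∨ (x 0 = 0 ∧ x 1 ≠ 0 ∧ kOf x = 1 ∧ i = 2) := by
      by_cases h0 : x 0 ≠ 0
      · exact Or.inl ⟨h0, by rw [hk_def]; dsimp only; rw [if_pos h0]⟩
      · right
        push Not at h0
        rcases (hmemA (x, i)).1 he with ⟨-, h0'⟩ | ⟨h2, h01'⟩
        · exact absurd h0 h0'
        · exact ⟨h0, fun h1 => h01' ⟨h0, h1⟩, by rw [hk_def]; dsimp only; rw [if_neg (not_not.2 h0)], h2⟩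
    have hi12 : i = 1 ∨ i = 2 := by
      rcases (hmemA (x, i)).1 he with ⟨h1, -⟩ | ⟨h2, -⟩
      · exact Or.inl h1
      · exact Or.inr h2
    -- the direction-`k` letters: unassigned (`k = 0`) or of rank `≥ 2n + 1 > r(x,2)` (`k = 1`)
    have hkdir : ∀ y : Site 3 n, ((y, kOf x) : Edge 3 n) ∈ {j : Edge 3 n | j ≠ (x, i) ∧ (j ∈ A → r (x, i) < r j)} := by
      intro y
      refine ⟨fun h => ?_, fun hmem => ?_⟩
      · have hki : kOf x = i := congrArg Prod.snd h
        rcases hk_cases with ⟨-, hk0⟩ | ⟨-, -, hk1, hi2⟩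
        · rw [hk0] at hki
          rcases hi12 with h | h
          · exact h01 (hki.trans h)
          · exact h02 (hki.trans h)
        · rw [hk1, hi2] at hki
          exact h12 hki
      · rcases hk_cases with ⟨-, hk0⟩ | ⟨hx0, hx1, hk1, hi2⟩
        · rw [hk0] at hmem
          exact absurd hmem (hmemA0 y)
        · rw [hk1] at hmem ⊢
          subst hi2
          have hy0 : y 0 ≠ 0 := (hmemA1 y).1 hmem
          rw [hr1 y, hr2 x, if_neg (not_not.2 hx0)]
          have h1 := (val_sub_one_of_ne_zero hn hx1).1
          have h2 := (hval y).1
          omega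
    -- the parallel letter `(x − e_k, i)`: unassigned or of higher rank
    have hpar : ((x - Pi.single (kOf x) 1, i) : Edge 3 n) ∈
        {j : Edge 3 n | j ≠ (x, i) ∧ (j ∈ A → r (x, i) < r j)} := by
      refine ⟨fun h => sub_single_ne hn x (kOf x) (congrArg Prod.fst h), fun hmem => ?_⟩
      rcases hk_cases with ⟨hx0, hk0⟩ | ⟨hx0, hx1, hk1, hi2⟩
      · -- `k = 0`: the letter is `(x − e₀, i)`, with `(x − e₀)₀ = x₀ − 1`, `(x − e₀)₁ = x₁`
        rw [hk0] at hmem ⊢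
        have hc0 : (x - Pi.single (0 : Fin 3) (1 : ZMod n) : Site 3 n) 0 = x 0 - 1 := by simp
        have hc1 : (x - Pi.single (0 : Fin 3) (1 : ZMod n) : Site 3 n) 1 = x 1 := by simp
        obtain ⟨hx0v, hsubv⟩ := val_sub_one_of_ne_zero hn hx0
        have hxv := (hval x).1
        rcases hi12 with hi | hi
        · subst hi
          rw [hr1, hr1, hc0, hsubv]
          omega
        · subst hi
          rw [hr2, hr2, if_pos hx0, hc0, hc1]
          by_cases hy0 : x 0 - 1 ≠ 0
          · rw [if_pos hy0, hsubv]
            omega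
          · rw [if_neg hy0]
            have := (hval x).2
            omega
      · -- `k = 1`: the letter is `(x − e₁, 2)`, with `(x − e₁)₀ = x₀ = 0`, `(x − e₁)₁ = x₁ − 1`
        subst hi2
        rw [hk1] at hmem ⊢
        have hc0 : (x - Pi.single (1 : Fin 3) (1 : ZMod n) : Site 3 n) 0 = x 0 := by simp
        have hc1 : (x - Pi.single (1 : Fin 3) (1 : ZMod n) : Site 3 n) 1 = x 1 - 1 := by simp
        obtain ⟨hx1v, hsubv⟩ := val_sub_one_of_ne_zero hn hx1
        have hxv := (hval x).2
        have hy1 : x 1 - 1 ≠ 0 := by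
          intro h
          have hmem' := (hmemA2 _).1 hmem
          rw [hc0, hc1] at hmem'
          exact hmem' ⟨hx0, h⟩
        rw [hr2, hr2, if_neg (not_not.2 hx0), hc0, if_neg (not_not.2 hx0), hc1, hsubv]
        omega
    refine ⟨fun U V hUV => hUV _ (hkdir _), fun U V hUV => ?_⟩
    show (U (yOf (x, i) + Pi.single i 1, kOf x))⁻¹ * (U (yOf (x, i), i))⁻¹ =
      (V (yOf (x, i) + Pi.single i 1, kOf x))⁻¹ * (V (yOf (x, i), i))⁻¹
    rw [hUV _ (hkdir _), hUV _ hpar]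
  -- (iv) the integrand: private plaquettes as words, the remaining plaquettes dropped
  set img : Finset (Plaquette 3 n) := A.image P with himg_def
  set R : (Edge 3 n → G) → ℝ := fun U => ∏ p ∈ univ \ img, w p (plaquetteHolonomy U p.1 p.2.1.1 p.2.1.2) with hR_def
  have hR0 : ∀ U, 0 ≤ R U := fun U => prod_nonneg fun p _ => hw0 _ _
  have hR1 : ∀ U, R U ≤ 1 := fun U => prod_le_one (fun p _ => hw0 _ _) fun p _ => hw1 _ _
  have hsplit : ∀ U : Edge 3 n → G, ∏ p : Plaquette 3 n, w p (plaquetteHolonomy U p.1 p.2.1.1 p.2.1.2) =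
      (∏ e ∈ A, (fun e' => w (P e')) e (a e U * U e * b e U)) * R U := by
    intro U
    have hs := prod_sdiff (subset_univ img) (f := fun p : Plaquette 3 n => w p (plaquetteHolonomy U p.1 p.2.1.1 p.2.1.2))
    rw [← hs, mul_comm, himg_def, prod_image hinj]
    congr 1
    exact prod_congr rfl fun e he => hword e he U
  simp_rw [hsplit]
  -- (v) the abstract triangular bound, (vi) the count
  have hmain := integral_prod_words_mul_le_pow μ₀ r A (a := a) (b := b)
    (fun e => measurable_pi_apply _)
    (fun e => ((measurable_pi_apply _).inv).mul (measurable_pi_apply _).inv) hdep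
    (w := fun e => w (P e)) (fun e => hwm _) (fun e g => hw0 _ _) (B := 1) (fun e g => hw1 _ _) hR0 hR1
    (z := z) (fun e _ => hz _)
  have hcard : A.card = 2 * n ^ 3 - n ^ 2 - n := by
    rw [hA_def]
    convert card_assigned n
  rw [hcard] at hmain
  exact hmain

/-! ## §3 The door's `hZup` letter: the Wilson–Boltzmann integral on the three-torus -/

/-- **THE UPPER BOUND ON THE WILSON PARTITION FUNCTION OF THE THREE-TORUS** (the `hZup` hypothesis of
✓`PlaquetteExpMoment.integral_exp_mul_plaquette_le_of_sandwich`): for a compact second-countable group `G`, a continuous unitary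
representation `ρ : G →* M_N(ℂ)`, `1 < n` and `β′ ≥ 0`,
`∫⁻ exp(−β′·S_W(U)) dπ ≤ ofReal ((∫ exp(−β′(N − Re tr ρ g)) dHaar(g))^{2n³ − n² − n})`,
`π` = product Haar on `GaugeConfig 3 n G`.  (§2 at the weights `w_p := exp(−β′(N − Re tr ρ ·)) ∈ (0,1]`.) [folklore] -/
theorem lintegral_exp_neg_mul_wilsonAction_le {n m : ℕ} [NeZero n] [NeZero m] (hn : 1 < n)
    {G : Type*} [Group G] [TopologicalSpace G] [IsTopologicalGroup G] [CompactSpace G]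
    [MeasurableSpace G] [BorelSpace G] [SecondCountableTopology G]
    (ρ : G →* Matrix (Fin m) (Fin m) ℂ) (hρu : ∀ g, ρ g ∈ Matrix.unitaryGroup (Fin m) ℂ) (hρc : Continuous ρ)
    {β' : ℝ} (hβ' : 0 ≤ β') :
    ∫⁻ U, ENNReal.ofReal (Real.exp (-β' * wilsonAction ρ U)) ∂(Measure.pi fun _ : Edge 3 n => haarProbability G) ≤
      ENNReal.ofReal ((∫ g, Real.exp (-β' * ((m : ℝ) - (ρ g).trace.re)) ∂haarProbability G) ^ (2 * n ^ 3 - n ^ 2 - n)) := by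
  haveI : IsProbabilityMeasure (haarProbability G) :=
    ⟨by simpa [haarProbability] using (Measure.haarMeasure_self (G := G) (K₀ := ⊤))⟩
  -- the plaquette weight
  set wt : G → ℝ := fun g => Real.exp (-β' * ((m : ℝ) - (ρ g).trace.re)) with hwt_def
  have hwtm : Measurable wt := by
    refine (Real.continuous_exp.comp (continuous_const.mul (continuous_const.sub ?_))).measurable
    exact Complex.continuous_re.comp (continuous_id.matrix_trace.comp hρc)
  have hwt0 : ∀ g, 0 ≤ wt g := fun g => (Real.exp_pos _).le
  have hwt1 : ∀ g, wt g ≤ 1 := fun g => by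
    rw [hwt_def]; dsimp only
    rw [Real.exp_le_one_iff, neg_mul, neg_nonpos]
    exact mul_nonneg hβ' (PlaquetteTail.actionTerm_nonneg ρ hρu g)
  -- the Boltzmann factor is the product of the plaquette weights
  have hexp : ∀ U : GaugeConfig 3 n G, Real.exp (-β' * wilsonAction ρ U) =
      ∏ p : Plaquette 3 n, wt (plaquetteHolonomy U p.1 p.2.1.1 p.2.1.2) := by
    intro U
    rw [wilsonAction, mul_sum, Real.exp_sum]
  have hprodm : Measurable fun U : GaugeConfig 3 n G => ∏ p : Plaquette 3 n, wt (plaquetteHolonomy U p.1 p.2.1.1 p.2.1.2) := by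
    refine Finset.measurable_prod _ fun p _ => hwtm.comp ?_
    have h : ∀ e : Edge 3 n, Measurable fun U : GaugeConfig 3 n G => U e := fun e => measurable_pi_apply e
    unfold plaquetteHolonomy
    exact (((h _).mul (h _)).mul (h _).inv).mul (h _).inv
  have hprod0 : ∀ U : GaugeConfig 3 n G, 0 ≤ ∏ p : Plaquette 3 n, wt (plaquetteHolonomy U p.1 p.2.1.1 p.2.1.2) :=
    fun U => prod_nonneg fun p _ => hwt0 _
  have hprod1 : ∀ U : GaugeConfig 3 n G, ∏ p : Plaquette 3 n, wt (plaquetteHolonomy U p.1 p.2.1.1 p.2.1.2) ≤ 1 :=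
    fun U => prod_le_one (fun p _ => hwt0 _) fun p _ => hwt1 _
  have hint : Integrable (fun U : GaugeConfig 3 n G => ∏ p : Plaquette 3 n, wt (plaquetteHolonomy U p.1 p.2.1.1 p.2.1.2))
      (Measure.pi fun _ : Edge 3 n => haarProbability G) :=
    Integrable.of_bound hprodm.aestronglyMeasurable 1 (ae_of_all _ fun U => by
      rw [Real.norm_eq_abs, abs_of_nonneg (hprod0 U)]; exact hprod1 U)
  simp_rw [hexp]
  rw [← ofReal_integral_eq_lintegral_ofReal hint (ae_of_all _ hprod0)]
  refine ENNReal.ofReal_le_ofReal ?_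
  exact integral_prod_plaquetteWeight_le_pow hn (haarProbability G) (fun _ => wt) (fun _ => hwtm) (fun _ g => hwt0 g)
    (fun _ g => hwt1 g) (z := ∫ g, wt g ∂haarProbability G) (fun _ => le_rfl)

end

end Summit.QuantumFields.YangMills.Theorems.LocalInsertion.TriangularPlaquette
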